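import Mathlib
import Literature.MathematicalPhysics.QuantumFieldTheory.Balaban1983to89.B12Moments443

/-!
# `Balaban1983to89.B14.Eq364Beta` — [Balaban1988Convergent] (2.26) p. 259 and (3.61)–(3.64) pp. 282–283: the
# coefficient `β′_j = Π^{(j)}_{22,11}` of the marginal term, the resummation chain (3.62) ON THE INFINITE LATTICE, the
# identification (3.63) with the vacuum-polarization kernel of [I], and (3.64) "This is the required equality"
# `β′_j = −½ Σ_x Π^{(j)}_{22}(x) x₁² = ½ (∂²/∂p₁² Π̃^{(j)}_{22})(0) = β_j` PROVED from the [I]-side data of the tree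

statement-level skeleton of published theorems with citation tags; proofs where landed; nothing here is a
claim about the Yang–Mills mass gap

PDF held: `paper:balaban1988-cmp119-convergent-renormalization` (journal page = PDF page + 242); (2.26)–(2.27) read on the
x2 render `…-p017-x2.png` (p. 259), (3.58)–(3.63) on `…-p040-x2.png` (p. 282), (3.64)–(3.67) on `…-p041-x2.png` (p. 283)
of `run/shared/lean/pub/pub-balaban/b2b-balaban-ref1/pages/1988-cmp119-convergent-renormalization/`.

CITATION HEADER (lean-in-tree rule).  Source: T. Bałaban, *Convergent renormalization expansions for lattice gauge
theories*, Commun. Math. Phys. **119**, 243–285 (1988), doi:10.1007/bf01217741 [Balaban1988Convergent] (cell paper B14 =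
"[III]"; "[I]" = T. Bałaban, Commun. Math. Phys. **109** (1987) 249–301 [Balaban1987RG1], cell paper B12).
Mega-formalization `lit-balaban` (HOME `run/shared/lean/pub/lit-balaban/`), reader/typer unit `lit-balaban-r11`
(generation 3), SKELETON rows **B14.Eq2.26–2.27** ((2.26) as a displayed identity was absent), **B14.Eq3.58–3.61**
((3.61)'s `β′_j` as a named object), **B14.Eq3.62–3.64** ((3.62) first equality = `B14Sect3.beta_resum_362`, FINITE index
set; (3.63), (3.64) were absent).

THE PRINTED TEXT (verbatim).  p. 259 [PDF 17]: *"Let us denote by Λ⁰_j the set which is obtained by removing one layer of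
the MR_j-cubes from Λ^{(j)}_j ⊂ T^{(j)}_1. The following representations hold:
  𝐄^{(j)}(Λ_j, U_k) = Σ_{z∈Λ⁰_j} 𝐄^{(j)}(Λ_j, U_k, z),   (2.26)
  𝐄^{(j)}(Λ_j, U_k, z) = Σ_{X∋z} 𝐄^{(j)}(X, U_k, z),   (2.27)"*.
p. 282 [PDF 40]: *"Thus we obtain  (3.57) = β′_j ½ Σ_{μ<ν} tr F²_{μν}(z),  β′_j = Π^{(j)}_{22,11}.   (3.61)
The last identity can be considered as a possible definition of the β-function. Now we prove that it coincides with the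
definition (I.1.22). Using the translation invariance and the identity (I.4.15) again we have
  β′_j = Σ_{x,y} Π^{(j)}_{22}(x, y, 0)x₁y₁ = −½ Σ_{x,y} Π^{(j)}_{22}(x, y, 0)(x₁ − y₁)²
       = −½ Σ_{x,y} Π^{(j)}_{22}(z − y, 0, −y)(x₁ − y₁)² = −½ Σ_{x,z} Π^{(j)}_{22}(x, 0, z)x₁² .   (3.62)
From the equality (2.26) for Λ_j = L^{−j}Z^d, and from the definitions (I.1.20), (I.5.1), we obtain
  Σ_z Π^{(j)}_{μν}(x, y, z) = Π^{(j)}_{μν}(x − y) .   (3.63)"*  p. 283 [PDF 41]: *"Thus the representation (I.5.16), or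
(I.5.37), implies  β′_j = −½ Σ_z Π^{(j)}_{22}(x)x₁² = ½ ((∂²/∂p₁²) Π̃^{(j)}_{22})(0) = β_j .   (3.64)
This is the required equality."*  (Here `Π^{(j)}_{μν,κλ} = Σ_{x,y} Π^{(j)}_{μν}(x,y,z)(x_κ − z_κ)(y_λ − z_λ)`, p. 281, is
independent of `z` by translation invariance; `Π^{(j)}_{μν}(x,y,z)` is "given by the formula (3.50), but with
𝐄^{(j)}(X, U_j, z) replaced by 𝐄^{(j)}(U_j, z) defined on the whole lattice L^{−j}Z^d", p. 281.)
READING NOTES. (a) The third member of (3.62) prints `Π^{(j)}_{22}(z − y, 0, −y)`; at that point `z` is the fixed third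
argument `0` of the previous member and the summation variables are `x, y` — the member is typed as
`Π^{(j)}_{22}(x − y, 0, −y)(x₁ − y₁)²`, which is what translation invariance gives termwise and what the fourth member
re-indexes (`eq362b`).  (b) The first sum of (3.64) prints `Σ_z Π^{(j)}_{22}(x)x₁²`; the summation variable is `x`
(typed so).  Neither affects the chain.

THE MODEL.  The infinite lattice `L^{−j}Z^d` is indexed by `Pt d = Fin d → ℤ` (lattice units; the cell's [I]-side files
`…B12Beta`, `…B12Rep537`, `…B12Moments443` index `Π_{μν}(x)` and `β = Σ_x Π_{μν}(x)x_μx_ν` ((I.1.22) = (I.5.42)) the same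
way, so the homogeneous weights `x₁y₁`, `x₁²` scale both sides of (3.62)–(3.64) alike).  The three-point kernel
`Π^{(j)}_{μν}(x, y, z)` is an abstract `P3 : Fin d → Fin d → Pt d → Pt d → Pt d → ℝ`; [I]'s kernel is a `B12Beta.Kernel d`.
Double lattice sums are `tsum`s over `Pt d × Pt d`; every interchange is justified from an explicit product-form
exponential decay hypothesis `Decay3 P3 C κ` (`|Π(x,y,z)| ≤ C e^{−κ|x−z|₁} e^{−κ|y−z|₁}` — a tree-decay consequence of the
printed bound (3.48) `|𝐄^{(j)}(X,z)| ≤ E₀ exp(−κ(LʲL⁻ⁿ)⁻¹) exp(−½κd_j(X))`, displayed as the hypothesis actually used).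

WHAT IS TYPED (definitions with bodies): `Eq226` — (2.26) as a `Prop` over abstract configuration data; `TranslInv`,
`Decay3` — the two standing properties of the whole-lattice three-point kernel used on p. 282 (*"Using the translation
invariance …"*, (3.48)); `betaPrime P3 one two` — **(3.61)** `β′_j = Π^{(j)}_{22,11} = Σ_{x,y} Π^{(j)}_{22}(x,y,0) x₁y₁` (at
`z = 0`); `Eq363 P3 P` — **(3.63)** as a `Prop`; `symbolAxis P κ p` — the lattice Fourier transform `Π̃(p) = Σ_x e^{−ip·x}Π(x)`
((I.5.11)) restricted to the `p_κ`-axis.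
WHAT IS PROVED:
* `iteratedFDeriv_two_of_eq226` — (2.26) differentiated twice at `B = 0` is the bond-wise sum of second derivatives (the
  step "(2.26) ⇒ (3.63)" up to the definitions (I.1.20), (I.5.1) of [I], which are not in the tree);
* **`eq362a`**, **`eq362b`**, **`eq362c`** — the three equalities of (3.62) on the INFINITE lattice: (a) from the vanishing of
  both marginals `Σ_x Π(x,y,0) = 0 = Σ_y Π(x,y,0)` (the print's "(I.4.15) again"; hypotheses, as in
  `B14Sect3.beta_resum_362`) with all Fubini interchanges justified from `Decay3`; (b) termwise translation invariance;
  (c) the re-indexing `(x, y) ↦ (x − y, −y)` of `Z^d × Z^d`;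
* **`eq363_sum`** — (3.63) at `y = 0` turns the last member of (3.62) into `−½ Σ_x Π^{(j)}_{22}(x) x₁²` (Fubini from `Decay3`);
* **`eq364_moment`** — `−½ Σ_x Π_{22}(x) x₁² = β` for a kernel with [I]'s second-order Taylor data (I.5.16)/(I.5.36)
  (`B12Rep537.TaylorData3 β`, the tree's typed form of "the representation (I.5.16), or (I.5.37)"), via
  `B12Moments443.moments443` (`Σ_x Π_{μν}(x)x_κx_λ = β(δ_{μκ}δ_{νλ} + δ_{μλ}δ_{νκ} − 2δ_{μν}δ_{κλ})` at `μ = ν = 2`, `κ = λ = 1`);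
  and `β = B12Beta.secondMoment Π 2 1` = (I.1.22) by `B12Rep537.beta_eq_secondMoment`;
* **`hasDerivAt_symbolAxis`**, **`hasDerivAt_deriv_symbolAxis`**, **`eq364_fourier`** — the middle member of (3.64):
  `½ (∂²/∂p₁² Π̃_{22})(0) = −½ Σ_x Π_{22}(x) x₁²` (termwise differentiation of the lattice Fourier series under the decay
  (I.5.10), Mathlib `hasDerivAt_tsum`) — the "standard passage" that `…B12Rep537` names as not formalised there;
* **`eq364`** — the whole chain: under `TranslInv`, `Decay3`, the two marginal identities, (3.63) and the Taylor data of
  [I]'s kernel, `β′_j = β_j` (*"This is the required equality"*).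
NOT HERE: that Bałaban's kernels SATISFY `TranslInv`/`Decay3`/the marginal identities/(3.63)/(I.5.16) (displayed
hypotheses, exactly the inputs the print invokes); (3.58)–(3.60) and (3.60) ⇒ (3.61) (tree: `B14Sect3.invariant_tensor_361`);
(2.27).  No `sorry`.
-/

noncomputable section

open _root_.Filter _root_.Topology Finset
open Literature.MathematicalPhysics.QuantumFieldTheory.GawedzkiKupiainen1985.PeriodicGleason
open Literature.MathematicalPhysics.QuantumFieldTheory.Balaban1983to89

namespace Literature.MathematicalPhysics.QuantumFieldTheory.Balaban1983to89.B14.Eq364Beta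

variable {d : ℕ}

/-! ## §1. (2.26) and its second derivative at `B = 0` -/

/-- **(2.26)**: `𝐄^{(j)}(Λ_j, U_k) = Σ_{z∈Λ⁰_j} 𝐄^{(j)}(Λ_j, U_k, z)` — the global term is the sum of its point-localized
pieces over the sites `z` of `Λ⁰_j` (one layer of `MR_j`-cubes removed), for every configuration.
[cite: Balaban1988Convergent, (2.26) p.259] -/
def Eq226 {Z Cfg : Type*} (EΛ : Cfg → ℝ) (Ez : Z → Cfg → ℝ) (Λ0 : Finset Z) : Prop :=
  ∀ U, EΛ U = ∑ z ∈ Λ0, Ez z U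

/-- (2.26) read on the background-field functions `B ↦ 𝐄^{(j)}(Λ_j, U_j(exp iB))`, `B ↦ 𝐄^{(j)}(Λ_j, U_j(exp iB), z)` and
differentiated twice at `B = 0`: the second derivative of the global term is the `z`-sum of the second derivatives of
the localized terms (each twice continuously differentiable at `0`) — the step *"From the equality (2.26) … we obtain
(3.63)"* up to the definitions (I.1.20), (I.5.1) of [I]. [cite: Balaban1988Convergent, (2.26) p.259, (3.63) p.282] -/
theorem iteratedFDeriv_two_of_eq226 {Z E : Type*} [NormedAddCommGroup E] [NormedSpace ℝ E] {FΛ : E → ℝ}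
    {Fz : Z → E → ℝ} {Λ0 : Finset Z} (h : Eq226 FΛ Fz Λ0) (hF : ∀ z ∈ Λ0, ContDiffAt ℝ 2 (Fz z) 0)
    (m : Fin 2 → E) :
    iteratedFDeriv ℝ 2 FΛ 0 m = ∑ z ∈ Λ0, iteratedFDeriv ℝ 2 (Fz z) 0 m := by
  have hfun : FΛ = fun B => ∑ z ∈ Λ0, Fz z B := funext h
  rw [hfun, iteratedFDeriv_fun_sum_apply hF, _root_.sum_apply]

/-! ## §2. The whole-lattice three-point kernel: translation invariance, decay, (3.61), (3.63) -/

/-- *"This function is translation invariant"* (p. 281): `Π^{(j)}_{μν}(x + a, y + a, z + a) = Π^{(j)}_{μν}(x, y, z)`.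
[cite: Balaban1988Convergent, (3.57) p.281, (3.62) p.282] -/
def TranslInv (P3 : Fin d → Fin d → Pt d → Pt d → Pt d → ℝ) : Prop :=
  ∀ μ ν x y z a, P3 μ ν (x + a) (y + a) (z + a) = P3 μ ν x y z

/-- Product-form exponential decay of the three-point kernel about its localization point `z`:
`|Π^{(j)}_{μν}(x, y, z)| ≤ C e^{−κ|x−z|₁} e^{−κ|y−z|₁}` — the consequence of the printed bound (3.48)
(`|𝐄^{(j)}(X, z)| ≤ E₀ exp(−κ(LʲL⁻ⁿ)⁻¹) exp(−½κd_j(X))`, tree decay in the size of the localization domain containing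
`x, y, z`) that makes the lattice sums of (3.62)–(3.64) absolutely convergent. [cite: Balaban1988Convergent, (3.48) p.280] -/
def Decay3 (P3 : Fin d → Fin d → Pt d → Pt d → Pt d → ℝ) (C κ : ℝ) : Prop :=
  ∀ μ ν x y z, |P3 μ ν x y z| ≤ C * wt κ (x - z) * wt κ (y - z)

/-- **(3.61)**: `β′_j = Π^{(j)}_{22,11} = Σ_{x,y} Π^{(j)}_{22}(x, y, 0) x₁ y₁` — the second moment
`Π^{(j)}_{μν,κλ} = Σ_{x,y} Π^{(j)}_{μν}(x,y,z)(x_κ − z_κ)(y_λ − z_λ)` (p. 281) at `z = 0`, `μ = ν = two`, `κ = λ = one`, as one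
absolutely convergent sum over `Z^d × Z^d`. [cite: Balaban1988Convergent, (3.61) p.282] -/
def betaPrime (P3 : Fin d → Fin d → Pt d → Pt d → Pt d → ℝ) (one two : Fin d) : ℝ :=
  ∑' q : Pt d × Pt d, P3 two two q.1 q.2 0 * ((q.1 one : ℝ) * (q.2 one : ℝ))

/-- **(3.63)**: `Σ_z Π^{(j)}_{μν}(x, y, z) = Π^{(j)}_{μν}(x − y)` — the `z`-summed three-point kernel is the (translation
invariant) vacuum-polarization kernel of [I] ((I.1.20)/(I.1.21), (I.5.1); in the tree `B12Beta.Kernel d`).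
[cite: Balaban1988Convergent, (3.63) p.282] -/
def Eq363 (P3 : Fin d → Fin d → Pt d → Pt d → Pt d → ℝ) (P : B12Beta.Kernel d) : Prop :=
  ∀ μ ν x y, ∑' z, P3 μ ν x y z = P μ ν (x - y)

/-! ## §3. Absolute convergence from `Decay3` -/

/-- `1 ≤ Π_{j∈t} f j` for real factors `≥ 1`. [folklore] -/
private theorem one_le_prod_real {ι : Type*} (t : Finset ι) (f : ι → ℝ) (hf : ∀ j ∈ t, 1 ≤ f j) :
    1 ≤ ∏ j ∈ t, f j := by
  calc (1:ℝ) = ∏ _j ∈ t, (1:ℝ) := Finset.prod_const_one.symm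
    _ ≤ ∏ j ∈ t, f j := Finset.prod_le_prod (fun _ _ => zero_le_one) hf

/-- A factor `≥ 1` among factors `≥ 1` is at most the product (real numbers). [folklore] -/
private theorem single_le_prod_real {ι : Type*} [DecidableEq ι] (t : Finset ι) (f : ι → ℝ)
    (hf : ∀ j ∈ t, 1 ≤ f j) {k : ι} (hk : k ∈ t) : f k ≤ ∏ j ∈ t, f j := by
  rw [← Finset.mul_prod_erase t f hk]
  have h1 := one_le_prod_real (t.erase k) f (fun j hj => hf j (Finset.mem_of_mem_erase hj))
  have h0 : 0 ≤ f k := le_trans zero_le_one (hf k hk)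
  nlinarith

/-- `(|x_κ| + 1)^p ≤ Π_j (|x_j| + 1)^p`. [folklore] -/
private theorem pow_le_pw (p : ℕ) (x : Pt d) (κ : Fin d) : (|(x κ : ℝ)| + 1) ^ p ≤ pw p x := by
  unfold pw
  exact single_le_prod_real Finset.univ (fun j => (|(x j : ℝ)| + 1) ^ p)
    (fun j _ => one_le_pow₀ (by linarith [abs_nonneg (x j : ℝ)])) (Finset.mem_univ κ)

/-- `|x_κ| ≤ Π_j (|x_j| + 1)`. [folklore] -/
private theorem abs_coord_le_pw_one (x : Pt d) (κ : Fin d) : |(x κ : ℝ)| ≤ pw 1 x :=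
  le_trans (by rw [pow_one]; linarith) (pow_le_pw 1 x κ)

/-- `x_κ² ≤ Π_j (|x_j| + 1)²`. [folklore] -/
private theorem sq_coord_le_pw_two (x : Pt d) (κ : Fin d) : (x κ : ℝ) ^ 2 ≤ pw 2 x := by
  refine le_trans ?_ (pow_le_pw 2 x κ)
  calc (x κ : ℝ) ^ 2 = |(x κ : ℝ)| ^ 2 := (sq_abs _).symm
    _ ≤ (|(x κ : ℝ)| + 1) ^ 2 := pow_le_pow_left₀ (abs_nonneg _) (by linarith) 2

/-- `1 ≤ Π_j (|x_j| + 1)^p`. [folklore] -/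
private theorem one_le_pw (p : ℕ) (x : Pt d) : 1 ≤ pw p x := by
  unfold pw
  exact one_le_prod_real Finset.univ _ (fun j _ => one_le_pow₀ (by linarith [abs_nonneg (x j : ℝ)]))

/-- The product weight `(e^{−κ|x|₁}(|x|+1)^p)·(e^{−κ|y|₁}(|y|+1)^p)` is summable over `Z^d × Z^d`. [folklore] -/
private theorem summable_wt_pw_prod {κ : ℝ} (hκ : 0 < κ) (p : ℕ) :
    Summable fun q : Pt d × Pt d => (wt κ q.1 * pw p q.1) * (wt κ q.2 * pw p q.2) :=
  (summable_wt_pw hκ p d).mul_of_nonneg (summable_wt_pw hκ p d)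
    (fun x => mul_nonneg (wt_pos κ x).le (pw_pos p x).le) (fun x => mul_nonneg (wt_pos κ x).le (pw_pos p x).le)

/-- Domination ⇒ summability over `Z^d × Z^d`. [folklore] -/
private theorem summable_of_le_wt_pw_prod {κ K : ℝ} (hκ : 0 < κ) (p : ℕ) {F : Pt d × Pt d → ℝ}
    (hF : ∀ q, |F q| ≤ K * ((wt κ q.1 * pw p q.1) * (wt κ q.2 * pw p q.2))) : Summable F :=
  Summable.of_norm_bounded ((summable_wt_pw_prod hκ p).mul_left K) fun q => by
    rw [Real.norm_eq_abs]; exact hF q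

/-- Domination ⇒ summability over `Z^d`. [folklore] -/
private theorem summable_of_le_wt_pw {κ K : ℝ} (hκ : 0 < κ) (p : ℕ) {F : Pt d → ℝ}
    (hF : ∀ x, |F x| ≤ K * (wt κ x * pw p x)) : Summable F :=
  Summable.of_norm_bounded ((summable_wt_pw hκ p d).mul_left K) fun x => by
    rw [Real.norm_eq_abs]; exact hF x

section Decay

variable {P3 : Fin d → Fin d → Pt d → Pt d → Pt d → ℝ} {C κ : ℝ}

/-- `0 ≤ C` under `Decay3` (evaluate at a point). [cite: Balaban1988Convergent, (3.48) p.280] -/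
theorem Decay3.nonneg (hD : Decay3 P3 C κ) (μ ν : Fin d) : 0 ≤ C := by
  have h := hD μ ν 0 0 0
  simp only [sub_self, wt_zero, mul_one] at h
  exact (abs_nonneg _).trans h

/-- At `z = 0` the kernel times any weight of size `≤ pw p x · pw p y` is summable over `Z^d × Z^d`.
[cite: Balaban1988Convergent, (3.48) p.280, (3.62) p.282] -/
theorem Decay3.summable_mul (hD : Decay3 P3 C κ) (hκ : 0 < κ) (μ ν : Fin d) (p : ℕ) {w : Pt d × Pt d → ℝ}
    (hw : ∀ q, |w q| ≤ pw p q.1 * pw p q.2) :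
    Summable fun q : Pt d × Pt d => P3 μ ν q.1 q.2 0 * w q := by
  refine summable_of_le_wt_pw_prod hκ p (K := C) fun q => ?_
  have h := hD μ ν q.1 q.2 0
  simp only [sub_zero] at h
  rw [abs_mul]
  calc |P3 μ ν q.1 q.2 0| * |w q| ≤ (C * wt κ q.1 * wt κ q.2) * (pw p q.1 * pw p q.2) :=
        mul_le_mul h (hw q) (abs_nonneg _) (by
          have := hD.nonneg μ ν
          exact mul_nonneg (mul_nonneg this (wt_pos κ _).le) (wt_pos κ _).le)
    _ = C * ((wt κ q.1 * pw p q.1) * (wt κ q.2 * pw p q.2)) := by ring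

/-- At `z = 0`, for fixed `x`, the `y`-fibre is summable (any weight of size `≤ pw p y`).
[cite: Balaban1988Convergent, (3.48) p.280, (3.62) p.282] -/
theorem Decay3.summable_fibre_y (hD : Decay3 P3 C κ) (hκ : 0 < κ) (μ ν : Fin d) (x : Pt d) (p : ℕ)
    {w : Pt d → ℝ} (hw : ∀ y, |w y| ≤ pw p y) :
    Summable fun y : Pt d => P3 μ ν x y 0 * w y := by
  refine summable_of_le_wt_pw hκ p (K := C * wt κ x) fun y => ?_
  have h := hD μ ν x y 0
  simp only [sub_zero] at h
  rw [abs_mul]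
  calc |P3 μ ν x y 0| * |w y| ≤ (C * wt κ x * wt κ y) * pw p y :=
        mul_le_mul h (hw y) (abs_nonneg _)
          (mul_nonneg (mul_nonneg (hD.nonneg μ ν) (wt_pos κ _).le) (wt_pos κ _).le)
    _ = C * wt κ x * (wt κ y * pw p y) := by ring

/-- At `z = 0`, for fixed `y`, the `x`-fibre is summable (any weight of size `≤ pw p x`).
[cite: Balaban1988Convergent, (3.48) p.280, (3.62) p.282] -/
theorem Decay3.summable_fibre_x (hD : Decay3 P3 C κ) (hκ : 0 < κ) (μ ν : Fin d) (y : Pt d) (p : ℕ)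
    {w : Pt d → ℝ} (hw : ∀ x, |w x| ≤ pw p x) :
    Summable fun x : Pt d => P3 μ ν x y 0 * w x := by
  refine summable_of_le_wt_pw hκ p (K := C * wt κ y) fun x => ?_
  have h := hD μ ν x y 0
  simp only [sub_zero] at h
  rw [abs_mul]
  calc |P3 μ ν x y 0| * |w x| ≤ (C * wt κ x * wt κ y) * pw p x :=
        mul_le_mul h (hw x) (abs_nonneg _)
          (mul_nonneg (mul_nonneg (hD.nonneg μ ν) (wt_pos κ _).le) (wt_pos κ _).le)
    _ = C * wt κ y * (wt κ x * pw p x) := by ring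

/-- With `y = 0`: the family `(x, z) ↦ Π(x, 0, z) x_κ²` is summable over `Z^d × Z^d` (re-index by `x ↦ x − z`:
`|x_κ|² ≤ pw 2 (x − z) · pw 2 z`). [cite: Balaban1988Convergent, (3.48) p.280, (3.62) p.282] -/
theorem Decay3.summable_xz (hD : Decay3 P3 C κ) (hκ : 0 < κ) (μ ν one : Fin d) :
    Summable fun q : Pt d × Pt d => P3 μ ν q.1 0 q.2 * (q.1 one : ℝ) ^ 2 := by
  -- transport along the equivalence (u, z) ↦ (u + z, z)
  let e : Pt d × Pt d ≃ Pt d × Pt d :=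
    { toFun := fun q => (q.1 + q.2, q.2)
      invFun := fun q => (q.1 - q.2, q.2)
      left_inv := fun q => by simp
      right_inv := fun q => by simp }
  have hs : Summable fun q : Pt d × Pt d => P3 μ ν (q.1 + q.2) 0 q.2 * ((q.1 + q.2) one : ℝ) ^ 2 := by
    refine summable_of_le_wt_pw_prod hκ 2 (K := C) fun q => ?_
    have h := hD μ ν (q.1 + q.2) 0 q.2
    simp only [add_sub_cancel_right, zero_sub] at h
    have hwt : wt κ (-q.2) = wt κ q.2 := by simp [wt, l1]
    rw [hwt] at h
    rw [abs_mul, abs_of_nonneg (sq_nonneg ((((q.1 + q.2) one : ℤ) : ℝ)))]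
    have hsq : (((q.1 + q.2) one : ℤ) : ℝ) ^ 2 ≤ pw 2 q.1 * pw 2 q.2 := by
      have h1 : (((q.1 + q.2) one : ℤ) : ℝ) ^ 2 ≤ (|(q.1 one : ℝ)| + 1) ^ 2 * (|(q.2 one : ℝ)| + 1) ^ 2 := by
        rw [← mul_pow]
        have : |(((q.1 + q.2) one : ℤ) : ℝ)| ≤ (|(q.1 one : ℝ)| + 1) * (|(q.2 one : ℝ)| + 1) := by
          simp only [Pi.add_apply, Int.cast_add]
          calc |(q.1 one : ℝ) + (q.2 one : ℝ)| ≤ |(q.1 one : ℝ)| + |(q.2 one : ℝ)| := abs_add_le _ _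
            _ ≤ (|(q.1 one : ℝ)| + 1) * (|(q.2 one : ℝ)| + 1) := by
                nlinarith [abs_nonneg (q.1 one : ℝ), abs_nonneg (q.2 one : ℝ)]
        calc (((q.1 + q.2) one : ℤ) : ℝ) ^ 2 = |(((q.1 + q.2) one : ℤ) : ℝ)| ^ 2 := (sq_abs _).symm
          _ ≤ ((|(q.1 one : ℝ)| + 1) * (|(q.2 one : ℝ)| + 1)) ^ 2 := pow_le_pow_left₀ (abs_nonneg _) this 2
      exact h1.trans (mul_le_mul (pow_le_pw 2 q.1 one) (pow_le_pw 2 q.2 one) (by positivity) (pw_pos 2 _).le)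
    calc |P3 μ ν (q.1 + q.2) 0 q.2| * (((q.1 + q.2) one : ℤ) : ℝ) ^ 2
        ≤ (C * wt κ q.1 * wt κ q.2) * (pw 2 q.1 * pw 2 q.2) :=
          mul_le_mul h hsq (sq_nonneg _)
            (mul_nonneg (mul_nonneg (hD.nonneg μ ν) (wt_pos κ _).le) (wt_pos κ _).le)
      _ = C * ((wt κ q.1 * pw 2 q.1) * (wt κ q.2 * pw 2 q.2)) := by ring
  have key : (fun q : Pt d × Pt d => P3 μ ν q.1 0 q.2 * (q.1 one : ℝ) ^ 2) ∘ e
      = fun q => P3 μ ν (q.1 + q.2) 0 q.2 * (((q.1 + q.2) one : ℤ) : ℝ) ^ 2 := by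
    funext q; simp [e]
  have h2 : Summable ((fun q : Pt d × Pt d => P3 μ ν q.1 0 q.2 * (q.1 one : ℝ) ^ 2) ∘ e) := by
    rw [key]; exact hs
  exact e.summable_iff.mp h2

/-- With `y = 0`, for fixed `x`: the `z`-fibre `z ↦ Π(x, 0, z)` is summable.
[cite: Balaban1988Convergent, (3.48) p.280, (3.63) p.282] -/
theorem Decay3.summable_fibre_z (hD : Decay3 P3 C κ) (hκ : 0 < κ) (μ ν : Fin d) (x : Pt d) :
    Summable fun z : Pt d => P3 μ ν x 0 z := by
  refine summable_of_le_wt_pw hκ 0 (K := C) fun z => ?_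
  have h := hD μ ν x 0 z
  simp only [zero_sub] at h
  have hwt : wt κ (-z) = wt κ z := by simp [wt, l1]
  rw [hwt] at h
  have h1 : wt κ (x - z) ≤ 1 := by
    unfold wt
    rw [show (1:ℝ) = Real.exp 0 by simp]
    exact Real.exp_le_exp.2 (by nlinarith [l1_nonneg (x - z), hκ.le])
  have hC := hD.nonneg μ ν
  have hw := (wt_pos κ z).le
  calc |P3 μ ν x 0 z| ≤ C * wt κ (x - z) * wt κ z := h
    _ ≤ C * 1 * wt κ z := by nlinarith [mul_nonneg (mul_nonneg hC hw) (sub_nonneg.2 h1)]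
    _ = C * (wt κ z * pw 0 z) := by simp

end Decay

/-! ## §4. (3.62): the resummation chain on the infinite lattice -/

section Eq362

variable {P3 : Fin d → Fin d → Pt d → Pt d → Pt d → ℝ} {C κ : ℝ}

/-- **(3.62), first equality** (*"Using the translation invariance and the identity (I.4.15) again"*): if both marginals
of `Π^{(j)}_{22}(·, ·, 0)` vanish — `Σ_x Π(x, y, 0) = 0` for every `y` and `Σ_y Π(x, y, 0) = 0` for every `x` (the first
Ward–Takahashi identity (I.4.15) with a linear gauge function; hypotheses, as in `B14Sect3.beta_resum_362`) — then
`Σ_{x,y} Π(x,y,0) x₁y₁ = −½ Σ_{x,y} Π(x,y,0)(x₁ − y₁)²`, all sums absolutely convergent by `Decay3`.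
[cite: Balaban1988Convergent, (3.62) p.282] -/
theorem eq362a (hD : Decay3 P3 C κ) (hκ : 0 < κ) (one two : Fin d)
    (hWx : ∀ y, ∑' x, P3 two two x y 0 = 0) (hWy : ∀ x, ∑' y, P3 two two x y 0 = 0) :
    betaPrime P3 one two
      = -(1/2 : ℝ) * ∑' q : Pt d × Pt d, P3 two two q.1 q.2 0 * ((q.1 one : ℝ) - (q.2 one : ℝ)) ^ 2 := by
  -- the three absolutely convergent double sums
  have hxy : Summable fun q : Pt d × Pt d => P3 two two q.1 q.2 0 * ((q.1 one : ℝ) * (q.2 one : ℝ)) :=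
    hD.summable_mul hκ two two 1 fun q => by
      rw [abs_mul]; exact mul_le_mul (abs_coord_le_pw_one _ _) (abs_coord_le_pw_one _ _) (abs_nonneg _)
        (pw_pos 1 _).le
  have hxx : Summable fun q : Pt d × Pt d => P3 two two q.1 q.2 0 * (q.1 one : ℝ) ^ 2 :=
    hD.summable_mul hκ two two 2 fun q => by
      rw [abs_of_nonneg (sq_nonneg _)]
      exact (sq_coord_le_pw_two _ _).trans (le_mul_of_one_le_right (pw_pos 2 _).le (one_le_pw 2 _))
  have hyy : Summable fun q : Pt d × Pt d => P3 two two q.1 q.2 0 * (q.2 one : ℝ) ^ 2 :=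
    hD.summable_mul hκ two two 2 fun q => by
      rw [abs_of_nonneg (sq_nonneg _)]
      exact (sq_coord_le_pw_two _ _).trans (le_mul_of_one_le_left (pw_pos 2 _).le (one_le_pw 2 _))
  -- Σ_{x,y} Π(x,y,0) x₁² = Σ_x x₁² Σ_y Π(x,y,0) = 0
  have hxx0 : ∑' q : Pt d × Pt d, P3 two two q.1 q.2 0 * (q.1 one : ℝ) ^ 2 = 0 := by
    rw [hxx.tsum_prod' (fun x => ((hD.summable_fibre_y hκ two two x 0 (w := fun _ => (1:ℝ))
      (fun y => by simp)).mul_right ((x one : ℝ) ^ 2)).congr fun y => by ring)]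
    refine (tsum_congr fun x => ?_).trans tsum_zero
    show ∑' y, P3 two two x y 0 * (x one : ℝ) ^ 2 = 0
    rw [tsum_mul_right, hWy x, zero_mul]
  -- Σ_{x,y} Π(x,y,0) y₁² = Σ_y y₁² Σ_x Π(x,y,0) = 0 (swap the product first)
  have hyy0 : ∑' q : Pt d × Pt d, P3 two two q.1 q.2 0 * (q.2 one : ℝ) ^ 2 = 0 := by
    have hsw : Summable fun q : Pt d × Pt d => P3 two two q.2 q.1 0 * (q.1 one : ℝ) ^ 2 :=
      (Equiv.prodComm (Pt d) (Pt d)).summable_iff.mpr hyy |>.congr fun q => by simp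
    rw [← (Equiv.prodComm (Pt d) (Pt d)).tsum_eq (fun q : Pt d × Pt d => P3 two two q.1 q.2 0 * (q.2 one : ℝ) ^ 2)]
    simp only [Equiv.prodComm_apply, Prod.fst_swap, Prod.snd_swap]
    rw [hsw.tsum_prod' (fun y => ((hD.summable_fibre_x hκ two two y 0 (w := fun _ => (1:ℝ))
      (fun x => by simp)).mul_right ((y one : ℝ) ^ 2)).congr fun x => by ring)]
    refine (tsum_congr fun y => ?_).trans tsum_zero
    show ∑' x, P3 two two x y 0 * (y one : ℝ) ^ 2 = 0
    rw [tsum_mul_right, hWx y, zero_mul]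
  -- assemble: x₁y₁ = −½(x₁−y₁)² + ½x₁² + ½y₁²
  have hexp : ∑' q : Pt d × Pt d, P3 two two q.1 q.2 0 * ((q.1 one : ℝ) - (q.2 one : ℝ)) ^ 2
      = ∑' q : Pt d × Pt d, P3 two two q.1 q.2 0 * (q.1 one : ℝ) ^ 2
        - 2 * ∑' q : Pt d × Pt d, P3 two two q.1 q.2 0 * ((q.1 one : ℝ) * (q.2 one : ℝ))
        + ∑' q : Pt d × Pt d, P3 two two q.1 q.2 0 * (q.2 one : ℝ) ^ 2 := by
    calc ∑' q : Pt d × Pt d, P3 two two q.1 q.2 0 * ((q.1 one : ℝ) - (q.2 one : ℝ)) ^ 2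
        = ∑' q : Pt d × Pt d, (P3 two two q.1 q.2 0 * (q.1 one : ℝ) ^ 2
            - 2 * (P3 two two q.1 q.2 0 * ((q.1 one : ℝ) * (q.2 one : ℝ)))
            + P3 two two q.1 q.2 0 * (q.2 one : ℝ) ^ 2) := tsum_congr fun q => by ring
      _ = _ := by
        rw [Summable.tsum_add (hxx.sub (hxy.mul_left 2)) hyy, Summable.tsum_sub hxx (hxy.mul_left 2),
          tsum_mul_left]
  unfold betaPrime
  rw [hexp, hxx0, hyy0]
  ring

/-- **(3.62), second equality** (translation invariance, termwise, shift by `−y`):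
`Σ_{x,y} Π(x,y,0)(x₁−y₁)² = Σ_{x,y} Π(x−y, 0, −y)(x₁−y₁)²`. [cite: Balaban1988Convergent, (3.62) p.282] -/
theorem eq362b (hT : TranslInv P3) (one two : Fin d) :
    ∑' q : Pt d × Pt d, P3 two two q.1 q.2 0 * ((q.1 one : ℝ) - (q.2 one : ℝ)) ^ 2
      = ∑' q : Pt d × Pt d, P3 two two (q.1 - q.2) 0 (-q.2) * ((q.1 one : ℝ) - (q.2 one : ℝ)) ^ 2 := by
  refine tsum_congr fun q => ?_
  have h := hT two two (q.1 - q.2) 0 (-q.2) q.2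
  rw [sub_add_cancel, zero_add, neg_add_cancel] at h
  rw [h]

/-- **(3.62), third equality** (re-indexing `Z^d × Z^d` by `(x, y) ↦ (x − y, −y)`):
`Σ_{x,y} Π(x−y, 0, −y)(x₁−y₁)² = Σ_{x,z} Π(x, 0, z) x₁²`. [cite: Balaban1988Convergent, (3.62) p.282] -/
theorem eq362c (P3 : Fin d → Fin d → Pt d → Pt d → Pt d → ℝ) (one two : Fin d) :
    ∑' q : Pt d × Pt d, P3 two two (q.1 - q.2) 0 (-q.2) * ((q.1 one : ℝ) - (q.2 one : ℝ)) ^ 2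
      = ∑' q : Pt d × Pt d, P3 two two q.1 0 q.2 * (q.1 one : ℝ) ^ 2 := by
  let e : Pt d × Pt d ≃ Pt d × Pt d :=
    { toFun := fun q => (q.1 - q.2, -q.2)
      invFun := fun q => (q.1 - q.2, -q.2)
      left_inv := fun q => by simp
      right_inv := fun q => by simp }
  rw [← e.tsum_eq (fun q : Pt d × Pt d => P3 two two q.1 0 q.2 * (q.1 one : ℝ) ^ 2)]
  refine tsum_congr fun q => ?_
  simp only [e, Equiv.coe_fn_mk, Pi.sub_apply, Int.cast_sub]

end Eq362

/-! ## §5. (3.63) ⇒ the last member of (3.62) is `−½ Σ_x Π^{(j)}_{22}(x) x₁²`; (3.64) -/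

section Eq364

variable {P3 : Fin d → Fin d → Pt d → Pt d → Pt d → ℝ} {C κ : ℝ} {P : B12Beta.Kernel d}

/-- **(3.62) + (3.63)**: `Σ_{x,z} Π(x, 0, z) x₁² = Σ_x Π_{22}(x) x₁²` — Fubini over `z` (from `Decay3`) and (3.63) at `y = 0`.
[cite: Balaban1988Convergent, (3.62)–(3.63) p.282, (3.64) p.283] -/
theorem eq363_sum (hD : Decay3 P3 C κ) (hκ : 0 < κ) (h363 : Eq363 P3 P) (one two : Fin d) :
    ∑' q : Pt d × Pt d, P3 two two q.1 0 q.2 * (q.1 one : ℝ) ^ 2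
      = ∑' x : Pt d, P two two x * (x one : ℝ) ^ 2 := by
  have hfib : ∀ x : Pt d, Summable fun z : Pt d => P3 two two x 0 z * (x one : ℝ) ^ 2 :=
    fun x => (hD.summable_fibre_z hκ two two x).mul_right ((x one : ℝ) ^ 2)
  rw [(hD.summable_xz hκ two two one).tsum_prod' hfib]
  refine tsum_congr fun x => ?_
  dsimp only
  rw [tsum_mul_right, h363 two two x 0, sub_zero]

/-- **(3.64), the moment form**: for a kernel with [I]'s second-order Taylor data `β × Q_{μν}`'s ((I.5.16)/(I.5.36), the
tree's `B12Rep537.TaylorData3`): `−½ Σ_x Π_{22}(x) x₁² = β` (`2 ≠ 1`), by `B12Moments443.moments443`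
(`Σ_x Π_{μν}(x) x_κx_λ = β(δ_{μκ}δ_{νλ} + δ_{μλ}δ_{νκ} − 2δ_{μν}δ_{κλ})`). [cite: Balaban1988Convergent, (3.64) p.283] -/
theorem eq364_moment {β : ℝ} (hT : ∀ μ ν, B12Rep537.TaylorData3 (β : ℂ) μ ν (B12Form543.ofRealK P μ ν))
    {one two : Fin d} (h12 : two ≠ one) :
    -(1/2 : ℝ) * ∑' x : Pt d, P two two x * (x one : ℝ) ^ 2 = β := by
  have h := B12Moments443.moments443 (Pc := B12Form543.ofRealK P) hT 0 two two one one
  rw [B12Moments443.M2x_eq_central] at h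
  have hk1 : B12Marginal444.kdA (A := ℂ) two one = 0 := by simp [B12Marginal444.kdA, h12]
  have hk2 : B12Marginal444.kdA (A := ℂ) two two = 1 := by simp [B12Marginal444.kdA]
  have hk3 : B12Marginal444.kdA (A := ℂ) one one = 1 := by simp [B12Marginal444.kdA]
  rw [hk1, hk2, hk3] at h
  have hC : ((∑' x : Pt d, P two two x * (x one : ℝ) ^ 2 : ℝ) : ℂ) = (β : ℂ) * (-2) := by
    rw [Complex.ofReal_tsum]
    have : (fun x : Pt d => ((P two two x * (x one : ℝ) ^ 2 : ℝ) : ℂ))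
        = fun z : Pt d => B12Form543.ofRealK P two two z * (((z one : ℤ) : ℂ) * ((z one : ℤ) : ℂ)) := by
      funext x
      simp only [B12Form543.ofRealK, B12Rep537.ofReal]
      push_cast
      ring
    rw [this, h]
    ring
  have hR : ∑' x : Pt d, P two two x * (x one : ℝ) ^ 2 = β * (-2) := by exact_mod_cast hC
  rw [hR]
  ring

/-- The `β` of the Taylor data IS (I.1.22)'s second moment `Σ_x Π_{21}(x) x₂x₁` (`B12Rep537.beta_eq_secondMoment`).
[cite: Balaban1988Convergent, (3.64) p.283] -/
theorem beta_eq_secondMoment {β : ℝ} (hT : ∀ μ ν, B12Rep537.TaylorData3 (β : ℂ) μ ν (B12Form543.ofRealK P μ ν))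
    {one two : Fin d} (h12 : two ≠ one) : β = B12Beta.secondMoment P two one :=
  B12Rep537.beta_eq_secondMoment (hT two one) h12

/-- **(3.62)–(3.64), the whole chain** — *"This is the required equality"*: for a translation invariant, decaying
three-point kernel with vanishing marginals at `z = 0`, related to [I]'s kernel `Π` by (3.63), and `Π` having [I]'s
second-order Taylor data with coefficient `β`: `β′_j = Π^{(j)}_{22,11} = β` (= `B12Beta.secondMoment Π 2 1`, (I.1.22)).
[cite: Balaban1988Convergent, (3.61)–(3.64) pp.282–283] -/
theorem eq364 (hT : TranslInv P3) (hD : Decay3 P3 C κ) (hκ : 0 < κ) {one two : Fin d} (h12 : two ≠ one)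
    (hWx : ∀ y, ∑' x, P3 two two x y 0 = 0) (hWy : ∀ x, ∑' y, P3 two two x y 0 = 0)
    (h363 : Eq363 P3 P) {β : ℝ} (hTD : ∀ μ ν, B12Rep537.TaylorData3 (β : ℂ) μ ν (B12Form543.ofRealK P μ ν)) :
    betaPrime P3 one two = β := by
  rw [eq362a hD hκ one two hWx hWy, eq362b hT, eq362c, eq363_sum hD hκ h363, eq364_moment hTD h12]

end Eq364

/-! ## §6. (3.64), middle member: the second derivative of the lattice Fourier transform at `p = 0` -/

section Fourier

variable {Pk : Pt d → ℝ} {a M : ℝ}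

/-- The lattice Fourier transform `Π̃(p) = Σ_x e^{−ip·x} Π(x)` ((I.5.11)) restricted to the `p_κ`-axis `p = p e_κ`:
`Σ_x Π(x) e^{−i p x_κ}`. [cite: Balaban1988Convergent, (3.64) p.283] -/
def symbolAxis (Pk : Pt d → ℝ) (κ : Fin d) (p : ℝ) : ℂ :=
  ∑' x : Pt d, (Pk x : ℂ) * Complex.exp ((p : ℂ) * (-((x κ : ℤ) : ℂ) * Complex.I))

/-- The phase factor has norm one. [folklore] -/
private theorem norm_exp_phase (p : ℝ) (x : Pt d) (κ : Fin d) :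
    ‖Complex.exp ((p : ℂ) * (-((x κ : ℤ) : ℂ) * Complex.I))‖ = 1 := by
  have : (p : ℂ) * (-((x κ : ℤ) : ℂ) * Complex.I) = ((-(p * (x κ : ℝ)) : ℝ) : ℂ) * Complex.I := by
    push_cast; ring
  rw [this, Complex.norm_exp_ofReal_mul_I]

/-- `d/dp e^{p w} = w e^{p w}` along the real parameter. [folklore] -/
private theorem hasDerivAt_exp_mul (w : ℂ) (p : ℝ) :
    HasDerivAt (fun q : ℝ => Complex.exp ((q : ℂ) * w)) (w * Complex.exp ((p : ℂ) * w)) p := by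
  have h0 : HasDerivAt (fun q : ℝ => (q : ℂ)) 1 p := by
    simpa using (hasDerivAt_id p).ofReal_comp
  have h1 : HasDerivAt (fun q : ℝ => (q : ℂ) * w) (1 * w) p := h0.mul_const w
  have h2 : HasDerivAt (fun q : ℝ => Complex.exp ((q : ℂ) * w)) (Complex.exp ((p : ℂ) * w) * (1 * w)) p :=
    (Complex.hasDerivAt_exp ((p : ℂ) * w)).comp p h1
  convert h2 using 1
  ring

/-- The decay bound in the complex reading. [folklore] -/
private theorem norm_coe_le (hP : ExpBound a M (B12Rep537.ofReal Pk)) (x : Pt d) : ‖(Pk x : ℂ)‖ ≤ M * wt a x :=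
  hP x

/-- **Termwise differentiation, first derivative**: under the decay (I.5.10) (`ExpBound a M`, `a > 0`) the axis symbol
is differentiable with `Π̃′(p) = Σ_x Π(x)(−i x_κ) e^{−ipx_κ}`. [cite: Balaban1988Convergent, (3.64) p.283] -/
theorem hasDerivAt_symbolAxis (hP : ExpBound a M (B12Rep537.ofReal Pk)) (ha : 0 < a) (κ : Fin d) (p : ℝ) :
    HasDerivAt (symbolAxis Pk κ)
      (∑' x : Pt d, (Pk x : ℂ) * ((-((x κ : ℤ) : ℂ) * Complex.I)
        * Complex.exp ((p : ℂ) * (-((x κ : ℤ) : ℂ) * Complex.I)))) p := by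
  unfold symbolAxis
  refine hasDerivAt_tsum (u := fun x : Pt d => M * (wt a x * pw 1 x)) ((summable_wt_pw ha 1 d).mul_left M)
    (fun x q => ((hasDerivAt_exp_mul _ q).const_mul (Pk x : ℂ))) (fun x q => ?_) (y₀ := 0) ?_ p
  · simp only [norm_mul, norm_neg, Complex.norm_I, mul_one, Complex.norm_intCast, norm_exp_phase]
    calc ‖(Pk x : ℂ)‖ * |((x κ : ℤ) : ℝ)| ≤ (M * wt a x) * pw 1 x :=
        mul_le_mul (norm_coe_le hP x) (abs_coord_le_pw_one x κ) (abs_nonneg _)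
          (mul_nonneg hP.nonneg (wt_pos a x).le)
      _ = M * (wt a x * pw 1 x) := by ring
  · have hs : Summable fun x : Pt d => (Pk x : ℂ) := hP.summable ha
    refine hs.congr fun x => ?_
    simp

/-- **Termwise differentiation, second derivative**: `Π̃″(p) = Σ_x Π(x)(−i x_κ)² e^{−ipx_κ}`.
[cite: Balaban1988Convergent, (3.64) p.283] -/
theorem hasDerivAt_deriv_symbolAxis (hP : ExpBound a M (B12Rep537.ofReal Pk)) (ha : 0 < a) (κ : Fin d) (p : ℝ) :
    HasDerivAt (deriv (symbolAxis Pk κ))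
      (∑' x : Pt d, (Pk x : ℂ) * ((-((x κ : ℤ) : ℂ) * Complex.I) * ((-((x κ : ℤ) : ℂ) * Complex.I)
        * Complex.exp ((p : ℂ) * (-((x κ : ℤ) : ℂ) * Complex.I))))) p := by
  have hd : deriv (symbolAxis Pk κ) = fun q : ℝ => ∑' x : Pt d, (Pk x : ℂ) * ((-((x κ : ℤ) : ℂ) * Complex.I)
      * Complex.exp ((q : ℂ) * (-((x κ : ℤ) : ℂ) * Complex.I))) :=
    funext fun q => (hasDerivAt_symbolAxis hP ha κ q).deriv
  rw [hd]
  refine hasDerivAt_tsum (u := fun x : Pt d => M * (wt a x * pw 2 x)) ((summable_wt_pw ha 2 d).mul_left M)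
    (fun x q => ((hasDerivAt_exp_mul _ q).const_mul _).const_mul (Pk x : ℂ))
    (fun x q => ?_) (y₀ := 0) ?_ p
  · simp only [norm_mul, norm_neg, Complex.norm_I, mul_one, Complex.norm_intCast, norm_exp_phase]
    have hsq : |((x κ : ℤ) : ℝ)| * |((x κ : ℤ) : ℝ)| ≤ pw 2 x := by
      rw [← sq, sq_abs]; exact sq_coord_le_pw_two x κ
    calc ‖(Pk x : ℂ)‖ * (|((x κ : ℤ) : ℝ)| * |((x κ : ℤ) : ℝ)|) ≤ (M * wt a x) * pw 2 x :=
        mul_le_mul (norm_coe_le hP x) hsq (by positivity) (mul_nonneg hP.nonneg (wt_pos a x).le)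
      _ = M * (wt a x * pw 2 x) := by ring
  · -- summability of the first-derivative series at `p = 0`
    have hs : Summable fun x : Pt d => (B12Rep537.ofReal Pk x) * (-((x κ : ℤ) : ℂ) * Complex.I) :=
      hP.summable_mul ha (K := 1) (p := 1) fun x => by
        rw [norm_mul, norm_neg, Complex.norm_I, mul_one, Complex.norm_intCast, one_mul]
        exact_mod_cast abs_coord_le_pw_one x κ
    refine hs.congr fun x => ?_
    simp [B12Rep537.ofReal]

/-- **(3.64), middle member**: `½ (∂²/∂p₁² Π̃_{22})(0) = −½ Σ_x Π_{22}(x) x₁²` — the second `p_κ`-derivative of the lattice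
Fourier transform at `p = 0` is minus the second moment (the identification of Taylor coefficients of `Π̃` at `0` with
monomial moments, under the decay (I.5.10)). [cite: Balaban1988Convergent, (3.64) p.283] -/
theorem eq364_fourier (hP : ExpBound a M (B12Rep537.ofReal Pk)) (ha : 0 < a) (κ : Fin d) :
    (1/2 : ℂ) * deriv (deriv (symbolAxis Pk κ)) 0
      = -(1/2 : ℂ) * ((∑' x : Pt d, Pk x * (x κ : ℝ) ^ 2 : ℝ) : ℂ) := by
  rw [(hasDerivAt_deriv_symbolAxis hP ha κ 0).deriv, Complex.ofReal_tsum]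
  have hI : ∀ x : Pt d, (Pk x : ℂ) * ((-((x κ : ℤ) : ℂ) * Complex.I) * ((-((x κ : ℤ) : ℂ) * Complex.I)
      * Complex.exp (((0 : ℝ) : ℂ) * (-((x κ : ℤ) : ℂ) * Complex.I))))
      = -(((Pk x * (x κ : ℝ) ^ 2 : ℝ)) : ℂ) := by
    intro x
    rw [Complex.ofReal_zero, zero_mul, Complex.exp_zero, mul_one]
    have hII : Complex.I * Complex.I = -1 := Complex.I_mul_I
    push_cast
    linear_combination ((Pk x : ℂ) * ((x κ : ℤ) : ℂ) ^ 2) * hII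
  rw [tsum_congr hI, tsum_neg]
  ring

end Fourier

end Literature.MathematicalPhysics.QuantumFieldTheory.Balaban1983to89.B14.Eq364Beta
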